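import Summits.HodgeConjecture.CorCM.Census.QuarticInversionLattice
import Summits.HodgeConjecture.CorCM.Census.QuarticInversionResidualBlocks

/-!
# The quartic inversion twists, XXIII: GENERATION — the Hodge lattice of the model is spanned, modulo pairs, by the translates of one
# reducing face per non-residual block and the ten closing faces

COR-CM (cell `pub-hodgecm2`, stage 2 of the Hodge ladder), count-neutral KERNEL COMBINATORICS by the binder seat b23 (gen 44; claim
QUARTIC-INVERSION, HOME/INBOX.md l.12829).  Part XXIII of the lane `Census/QuarticInversion*`, on top of parts I–XXII, all BY NAME.  Bookkeeping
definitions with bodies (`redSet`, `rep`, `blockFace`, `blockFaces`, `family`) + theorems; no `decide`, no certificate, no named fact, no geometry,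
no `sorry`.  `Interfaces.lean` (C1), every E term, B01, `Transposition/*`, `PortJoin/*` untouched.
HONEST FRAMING: `HC_CM` is NOT proved, here or anywhere in the tree; nothing here is a period, a count of record or a headline.

CONTENT (`|B|` odd `≥ 3`, square class `ζ`, a slot datum `(P,u₁,u₂;Q,w,u₀)` and a cross datum `(σ,s₀)` as in part XVII).
* §1 The set of all reducing faces is motion-stable, and the functionals of part VII kill the pairs and its span.
* §2 **The block faces**: one reducing face through a representative of every non-residual block; their orbit span covers every non-residual
  label by a potential-lowering vector (the cover moves along chains of motions).
* §3 **GENERATION** (`hodge₄_le`): `hodge₄ ≤ pairs₄ ⊔ orbSpan (blockFaces ∪ B1)`.  For `x ∈ hodge₄`: part XX gives `c ∈ orbSpan B1` with the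
  same values under every functional; the descent of part VI reduces `x − c` modulo `orbSpan blockFaces` to a residual vector, killed by every
  functional, hence a sum of pairs by the key lemma of part IX.
* §4 **THE COUNT** (`card_family_le`, `card_family_add_two_le`): the family has at most `#Block` members for every `ζ`, at most `#Block − 2`
  for `ζ = 0` (part XXII's residual blocks).  All [folklore].

## References
* [Pohlmann1968] H. Pohlmann, Algebraic cycles on abelian varieties of complex multiplication type, Ann. of Math. 88 (1968), Thm 1.
-/

namespace Summit.HodgeConjecture.CorCM.Census.QuarticInversion

open Finset
open Summit.HodgeConjecture.CorCM.Census.OddSliceFacesModel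

noncomputable section

variable (A : Type) [AddCommGroup A] [Fintype A] [DecidableEq A] (ζ : ZMod 2)

/-! ## §1 Reducing faces: motion-stable, killed by the functionals -/

/-- **The set of all reducing faces** (two distinct places; the three flipped corners of smaller potential, every half preserved). [folklore] -/
def redSet : Set (Ty₄ A → ℤ) :=
  {v | ∃ Θ p q, (p ≠ q ∧ ∀ c, pot₄ A (corner A Θ p q c) < pot₄ A Θ ∧ ∀ n, half A (coord A n (corner A Θ p q c)) = half A (coord A n Θ)) ∧
    v = faceVec₄ A Θ p q}

/-- The span of the reducing faces is stable under `H₀`. [folklore] -/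
theorem translH₄_mem_span_redSet (hA : Odd (Fintype.card A)) (g : ZMod 2 × A) {v : Ty₄ A → ℤ}
    (hv : v ∈ Submodule.span ℤ (redSet A)) : translH₄ A g v ∈ Submodule.span ℤ (redSet A) := by
  have hle : (Submodule.span ℤ (redSet A)).map (translH₄Hom A g) ≤ Submodule.span ℤ (redSet A) := by
    rw [Submodule.map_span]
    refine Submodule.span_mono ?_
    rintro _ ⟨u, ⟨Θ, p, q, h, rfl⟩, rfl⟩
    exact ⟨twH₄ A g Θ, plH A g p, plH A g q, reducing_twH₄ A hA g h, by rw [translH₄Hom_apply, translH₄_faceVec₄]⟩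
  exact hle (Submodule.mem_map_of_mem (f := translH₄Hom A g) hv)

/-- The span of the reducing faces is stable under `y`. [folklore] -/
theorem translY_mem_span_redSet (hA : Odd (Fintype.card A)) {v : Ty₄ A → ℤ} (hv : v ∈ Submodule.span ℤ (redSet A)) :
    translY A ζ v ∈ Submodule.span ℤ (redSet A) := by
  have hle : (Submodule.span ℤ (redSet A)).map (translYHom A ζ) ≤ Submodule.span ℤ (redSet A) := by
    rw [Submodule.map_span]
    refine Submodule.span_mono ?_
    rintro _ ⟨u, ⟨Θ, p, q, h, rfl⟩, rfl⟩
    exact ⟨twY A ζ Θ, plY A p, plY A q, reducing_twY A hA ζ h, by rw [translYHom_apply, translY_faceVec₄]⟩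
  exact hle (Submodule.mem_map_of_mem (f := translYHom A ζ) hv)

/-- The span of the reducing faces is stable under `t`. [folklore] -/
theorem translT_mem_span_redSet (hA : Odd (Fintype.card A)) {v : Ty₄ A → ℤ} (hv : v ∈ Submodule.span ℤ (redSet A)) :
    translT A v ∈ Submodule.span ℤ (redSet A) := by
  have hle : (Submodule.span ℤ (redSet A)).map (translTHom A) ≤ Submodule.span ℤ (redSet A) := by
    rw [Submodule.map_span]
    refine Submodule.span_mono ?_
    rintro _ ⟨u, ⟨Θ, p, q, h, rfl⟩, rfl⟩
    exact ⟨twT A Θ, plT A p, plT A q, reducing_twT A hA h, by rw [translTHom_apply, translT_faceVec₄]⟩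
  exact hle (Submodule.mem_map_of_mem (f := translTHom A) hv)

/-- **The functionals kill the pairs and the span of the reducing faces.** [folklore] -/
theorem killed_of_mem (hA : Odd (Fintype.card A)) {v : Ty₄ A → ℤ} (hv : v ∈ pairs₄ A ⊔ Submodule.span ℤ (redSet A)) :
    (∀ j η s, fnl A (wA A j η s) v = 0) ∧ ∀ η, fnl A (wC A η) v = 0 := by
  have hS : ∀ u ∈ redSet A, ∃ Θ p q, p ≠ q ∧ (∀ c, ∀ n, half A (coord A n (corner A Θ p q c)) = half A (coord A n Θ)) ∧
      u = faceVec₄ A Θ p q := by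
    rintro u ⟨Θ, p, q, h, rfl⟩
    exact ⟨Θ, p, q, h.1, fun c n => (h.2 c).2 n, rfl⟩
  exact ⟨fun j η s => fnl_eq_zero_of_mem_span A hA _ (Or.inl ⟨j, η, s, rfl⟩) _ hS hv,
    fun η => fnl_eq_zero_of_mem_span A hA _ (Or.inr ⟨η, rfl⟩) _ hS hv⟩

/-! ## §2 The block faces and their covering property -/

/-- A label in each block (a choice). [folklore] -/
def rep (B : Block A ζ) : Ty₄ A := Quotient.out B

omit [Fintype A] [DecidableEq A] in
/-- `rep B` lies in `B`. [folklore] -/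
theorem blk_rep (B : Block A ζ) : blk A ζ (rep A ζ B) = B := Quotient.out_eq B

omit [DecidableEq A] in
/-- The potential of the representative is the potential of the block. [folklore] -/
theorem pot₄_rep (B : Block A ζ) : pot₄ A (rep A ζ B) = potB A ζ B := by
  rw [← potB_blk A ζ, blk_rep]

/-- **The block face**: the reducing face of part VI through the representative (junk `0` for residual blocks). [folklore] -/
def blockFace (B : Block A ζ) : Ty₄ A → ℤ :=
  if h : 2 ≤ pot₄ A (rep A ζ B) then
    faceVec₄ A (rep A ζ B) (Classical.choose (exists_reducing A h)) (Classical.choose (Classical.choose_spec (exists_reducing A h)))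
  else 0

/-- The block face of a non-residual block is a reducing face through its representative. [folklore] -/
theorem blockFace_spec {B : Block A ζ} (hB : 2 ≤ potB A ζ B) :
    ∃ p q, (p ≠ q ∧ ∀ c, pot₄ A (corner A (rep A ζ B) p q c) < pot₄ A (rep A ζ B) ∧
      ∀ n, half A (coord A n (corner A (rep A ζ B) p q c)) = half A (coord A n (rep A ζ B))) ∧
      blockFace A ζ B = faceVec₄ A (rep A ζ B) p q := by
  have h : 2 ≤ pot₄ A (rep A ζ B) := by rw [pot₄_rep]; exact hB
  refine ⟨_, _, Classical.choose_spec (Classical.choose_spec (exists_reducing A h)), ?_⟩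
  rw [blockFace, dif_pos h]

/-- **The block faces**: one per non-residual block. [folklore] -/
def blockFaces : Finset (Ty₄ A → ℤ) := (univ.filter fun B : Block A ζ => 2 ≤ potB A ζ B).image (blockFace A ζ)

/-- Block faces are reducing faces. [folklore] -/
theorem blockFaces_subset_redSet : (↑(blockFaces A ζ) : Set (Ty₄ A → ℤ)) ⊆ redSet A := by
  intro v hv
  obtain ⟨B, hB, rfl⟩ := Finset.mem_image.mp (Finset.mem_coe.mp hv)
  obtain ⟨p, q, h, e⟩ := blockFace_spec A ζ (Finset.mem_filter.mp hB).2
  exact ⟨_, p, q, h, e⟩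

/-- Block faces are Hodge vectors. [folklore] -/
theorem blockFaces_subset_hodge₄ : (↑(blockFaces A ζ) : Set (Ty₄ A → ℤ)) ⊆ hodge₄ A := by
  intro v hv
  obtain ⟨Θ, p, q, h, rfl⟩ := blockFaces_subset_redSet A ζ hv
  exact faceVec₄_mem A Θ h.1

/-- There are at most as many block faces as non-residual blocks. [folklore] -/
theorem card_blockFaces_le : (blockFaces A ζ).card ≤ (univ.filter fun B : Block A ζ => 2 ≤ potB A ζ B).card :=
  Finset.card_image_le

/-- The orbit span of the block faces lies in the span of all reducing faces. [folklore] -/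
theorem orbSpan_blockFaces_le (hA : Odd (Fintype.card A)) : orbSpan A ζ ↑(blockFaces A ζ) ≤ Submodule.span ℤ (redSet A) :=
  orbSpan_le A ζ (fun _ hv => Submodule.subset_span (blockFaces_subset_redSet A ζ hv))
    (fun g _ hv => translH₄_mem_span_redSet A hA g hv) (fun _ hv => translY_mem_span_redSet A ζ hA hv)
    (fun _ hv => translT_mem_span_redSet A hA hv)

omit [DecidableEq A] in
/-- A covering vector moves with `H₀`. [folklore] -/
theorem cover_translH₄ (g : ZMod 2 × A) {v : Ty₄ A → ℤ} {Θ : Ty₄ A}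
    (hv : v Θ = 1 ∧ ∀ χ, χ ≠ Θ → v χ ≠ 0 → pot₄ A χ < pot₄ A Θ) :
    translH₄ A g v (twH₄ A g Θ) = 1 ∧ ∀ χ, χ ≠ twH₄ A g Θ → translH₄ A g v χ ≠ 0 → pot₄ A χ < pot₄ A (twH₄ A g Θ) := by
  have e : ∀ χ, translH₄ A g v χ = v (twH₄ A (-g) χ) := fun χ => rfl
  refine ⟨by rw [e, twH₄_twH₄, add_neg_cancel, twH₄_zero]; exact hv.1, fun χ hχ hne => ?_⟩
  rw [e] at hne
  have hχ' : twH₄ A (-g) χ ≠ Θ := fun h => hχ (by rw [← h, twH₄_twH₄, neg_add_cancel, twH₄_zero])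
  have := hv.2 _ hχ' hne
  rwa [pot₄_twH₄, ← pot₄_twH₄ A g Θ] at this

omit [DecidableEq A] in
/-- A covering vector moves with `y`. [folklore] -/
theorem cover_translY {v : Ty₄ A → ℤ} {Θ : Ty₄ A} (hv : v Θ = 1 ∧ ∀ χ, χ ≠ Θ → v χ ≠ 0 → pot₄ A χ < pot₄ A Θ) :
    translY A ζ v (twY A ζ Θ) = 1 ∧ ∀ χ, χ ≠ twY A ζ Θ → translY A ζ v χ ≠ 0 → pot₄ A χ < pot₄ A (twY A ζ Θ) := by
  have e : ∀ χ, translY A ζ v χ = v (twYinv A ζ χ) := fun χ => rfl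
  refine ⟨by rw [e, twYinv_twY]; exact hv.1, fun χ hχ hne => ?_⟩
  rw [e] at hne
  have hχ' : twYinv A ζ χ ≠ Θ := fun h => hχ (by rw [← h, twY_twYinv])
  have := hv.2 _ hχ' hne
  rwa [← pot₄_twY A ζ (twYinv A ζ χ), twY_twYinv, ← pot₄_twY A ζ Θ] at this

omit [AddCommGroup A] [DecidableEq A] in
/-- A covering vector moves with `t`. [folklore] -/
theorem cover_translT [AddCommGroup A] {v : Ty₄ A → ℤ} {Θ : Ty₄ A} (hv : v Θ = 1 ∧ ∀ χ, χ ≠ Θ → v χ ≠ 0 → pot₄ A χ < pot₄ A Θ) :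
    translT A v (twT A Θ) = 1 ∧ ∀ χ, χ ≠ twT A Θ → translT A v χ ≠ 0 → pot₄ A χ < pot₄ A (twT A Θ) := by
  have e : ∀ χ, translT A v χ = v (twTinv A χ) := fun χ => rfl
  refine ⟨by rw [e, twTinv_twT]; exact hv.1, fun χ hχ hne => ?_⟩
  rw [e] at hne
  have hχ' : twTinv A χ ≠ Θ := fun h => hχ (by rw [← h, twT_twTinv])
  have := hv.2 _ hχ' hne
  rwa [← pot₄_twT A (twTinv A χ), twT_twTinv, ← pot₄_twT A Θ] at this

omit [DecidableEq A] in
/-- **Covers move along chains of motions** inside an orbit span. [folklore] -/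
theorem cover_of_reach (F : Set (Ty₄ A → ℤ)) {Θ Θ' : Ty₄ A}
    (hreach : Relation.ReflTransGen
      (fun Θ₁ Θ₂ : Ty₄ A => (∃ g : ZMod 2 × A, Θ₂ = twH₄ A g Θ₁) ∨ Θ₂ = twY A ζ Θ₁ ∨ Θ₂ = twT A Θ₁) Θ Θ')
    (hcov : ∃ v ∈ orbSpan A ζ F, v Θ = 1 ∧ ∀ χ, χ ≠ Θ → v χ ≠ 0 → pot₄ A χ < pot₄ A Θ) :
    ∃ v ∈ orbSpan A ζ F, v Θ' = 1 ∧ ∀ χ, χ ≠ Θ' → v χ ≠ 0 → pot₄ A χ < pot₄ A Θ' := by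
  induction hreach with
  | refl => exact hcov
  | tail _ hs ih =>
    obtain ⟨v, hvF, hv⟩ := ih
    rcases hs with ⟨g, rfl⟩ | rfl | rfl
    · exact ⟨_, translH₄_mem_orbSpan A ζ F g hvF, cover_translH₄ A g hv⟩
    · exact ⟨_, translY_mem_orbSpan A ζ F hvF, cover_translY A ζ hv⟩
    · exact ⟨_, translT_mem_orbSpan A ζ F hvF, cover_translT A hv⟩

/-- **The orbit span of the block faces covers every non-residual label.** [folklore] -/
theorem blockFaces_cover (Ψ : Ty₄ A) (hΨ : 2 ≤ pot₄ A Ψ) :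
    ∃ v ∈ orbSpan A ζ ↑(blockFaces A ζ), v Ψ = 1 ∧ ∀ χ, χ ≠ Ψ → v χ ≠ 0 → pot₄ A χ < pot₄ A Ψ := by
  set B := blk A ζ Ψ with hBdef
  have hB : 2 ≤ potB A ζ B := by rw [hBdef, potB_blk]; exact hΨ
  have hreach := (blk_eq_blk_iff A ζ (rep A ζ B) Ψ).mp (blk_rep A ζ B)
  obtain ⟨p, q, h, e⟩ := blockFace_spec A ζ hB
  refine cover_of_reach A ζ _ hreach ⟨blockFace A ζ B, subset_orbSpan A ζ _ ?_, ?_⟩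
  · exact Finset.mem_coe.mpr (Finset.mem_image_of_mem _ (Finset.mem_filter.mpr ⟨Finset.mem_univ _, hB⟩))
  · rw [e]; exact faceVec₄_reducing A fun c => (h.2 c).1

/-! ## §3 Generation -/

omit [Fintype A] [DecidableEq A] in
/-- Orbit spans are monotone in the family. [folklore] -/
theorem orbSpan_mono {F F' : Set (Ty₄ A → ℤ)} (h : F ⊆ F') : orbSpan A ζ F ≤ orbSpan A ζ F' :=
  orbSpan_le A ζ (fun _ hf => subset_orbSpan A ζ F' (h hf)) (fun g _ hv => translH₄_mem_orbSpan A ζ F' g hv)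
    (fun _ hv => translY_mem_orbSpan A ζ F' hv) (fun _ hv => translT_mem_orbSpan A ζ F' hv)

/-- **The generating family**: the block faces and the ten closing faces. [folklore] -/
def family (P : Finset A) (u₁ u₂ : A) (Q : Finset A) (w u₀ : A) : Finset (Ty₄ A → ℤ) :=
  blockFaces A ζ ∪ famB1 A P u₁ u₂ Q w u₀

section Gen
variable {P : Finset A} {u₁ u₂ : A} {Q : Finset A} {w u₀ σ s₀ : A}

/-- **GENERATION: `hodge₄ ≤ pairs₄ ⊔ orbSpan (blockFaces ∪ B1)`** (`|B|` odd `≥ 3`, slot datum, cross datum). [folklore] -/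
theorem hodge₄_le (hA : Odd (Fintype.card A)) (h3 : 3 ≤ Fintype.card A) (h1 : u₁ ∉ P) (h2 : u₂ ∉ P) (h12 : u₁ ≠ u₂)
    (hP : P.card + 1 = Fintype.card A / 2) (hs₀ : s₀ ∈ insert u₁ (insert u₂ P))
    (hX : ∀ s, s + σ ∈ insert u₁ (insert u₂ P) ↔ (s ∉ insert u₁ (insert u₂ P) ∨ s = s₀)) (hw : w ∉ Q)
    (hQ : Q.card = Fintype.card A / 2) :
    hodge₄ A ≤ pairs₄ A ⊔ orbSpan A ζ ↑(family A ζ P u₁ u₂ Q w u₀) := by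
  intro x hx
  obtain ⟨c, hc, hAc⟩ := Submodule.mem_map.mp (Avec_mem_valMod_of_hodge A hA h3 ζ h1 h2 h12 hP hs₀ hX hw hQ (u₀ := u₀) hx)
  have hcH : c ∈ hodge₄ A := orbSpan_le_hodge₄ A ζ (famB1_subset_hodge₄ A (P := P) (Q := Q) (w := w) (u₀ := u₀) h12) hc
  obtain ⟨r, hres, hmem⟩ := descent_of_cover (pot₄ A) (orbSpan A ζ ↑(blockFaces A ζ)) (blockFaces_cover A ζ)
    (4 * Fintype.card A) (x - c) (fun χ _ => pot₄_le A χ)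
  have hkill := killed_of_mem A hA (Submodule.mem_sup_right (orbSpan_blockFaces_le A ζ hA hmem))
  have hval : ∀ w', (fnl A w' x = fnl A w' c) → fnl A w' (x - c - r) = 0 → fnl A w' r = 0 := by
    intro w' h h'
    rw [map_sub, map_sub, h, sub_self, zero_sub, neg_eq_zero] at h'
    exact h'
  have hkA : ∀ j η u, fnl A (wA A j η u) r = 0 := fun j η u =>
    hval _ (by have := congrFun hAc (Sum.inl (j, η, u)); simpa using this.symm) (hkill.1 j η u)
  have hkC : ∀ η, fnl A (wC A η) r = 0 := fun η =>
    hval _ (by have := congrFun hAc (Sum.inr η); simpa using this.symm) (hkill.2 η)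
  have hr : r ∈ pairs₄ A := mem_pairs₄_of_killed A hA h3 hres hkA hkC
  have e : x = c + (x - c - r) + r := by abel
  rw [e]
  refine Submodule.add_mem _ (Submodule.add_mem _ (Submodule.mem_sup_right ?_) (Submodule.mem_sup_right ?_))
    (Submodule.mem_sup_left hr)
  · exact orbSpan_mono A ζ (by simp [family]) hc
  · exact orbSpan_mono A ζ (by simp [family]) hmem

/-! ## §4 The count -/

/-- **`#family ≤ #Block`** for every `ζ` (`|B|` odd `≥ 3`). [folklore] -/
theorem card_family_le (hA : Odd (Fintype.card A)) (h2 : 2 ≤ Fintype.card A) :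
    (family A ζ P u₁ u₂ Q w u₀).card ≤ Fintype.card (Block A ζ) := by
  have hu := Finset.card_union_le (blockFaces A ζ) (famB1 A P u₁ u₂ Q w u₀)
  have hb := card_blockFaces_le A ζ
  have hf := card_famB1_le A P u₁ u₂ Q w u₀
  have hten := ten_le_card_residual A ζ hA h2
  have hpart := Finset.card_filter_add_card_filter_not (s := (univ : Finset (Block A ζ))) (fun B => potB A ζ B ≤ 1)
  have hneg : (univ.filter fun B : Block A ζ => ¬ potB A ζ B ≤ 1) = univ.filter fun B : Block A ζ => 2 ≤ potB A ζ B := by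
    refine Finset.filter_congr fun B _ => ?_; omega
  rw [hneg, Finset.card_univ] at hpart
  unfold family
  omega

/-- **`#family + 2 ≤ #Block` for `ζ = 0`** (`|B|` odd `≥ 3`). [folklore] -/
theorem card_family_add_two_le (hA : Odd (Fintype.card A)) (h2 : 2 ≤ Fintype.card A) :
    (family A 0 P u₁ u₂ Q w u₀).card + 2 ≤ Fintype.card (Block A 0) := by
  have hu := Finset.card_union_le (blockFaces A 0) (famB1 A P u₁ u₂ Q w u₀)
  have hb := card_blockFaces_le A 0
  have hf := card_famB1_le A P u₁ u₂ Q w u₀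
  have htw := twelve_le_card_residual A hA h2
  have hpart := Finset.card_filter_add_card_filter_not (s := (univ : Finset (Block A 0))) (fun B => potB A 0 B ≤ 1)
  have hneg : (univ.filter fun B : Block A 0 => ¬ potB A 0 B ≤ 1) = univ.filter fun B : Block A 0 => 2 ≤ potB A 0 B := by
    refine Finset.filter_congr fun B _ => ?_; omega
  rw [hneg, Finset.card_univ] at hpart
  unfold family
  omega

/-- The family consists of faces of the model: `faceVec₄ Θ p q` with `p ≠ q`. [folklore] -/
theorem family_shape (h12 : u₁ ≠ u₂) {f : Ty₄ A → ℤ} (hf : f ∈ family A ζ P u₁ u₂ Q w u₀) :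
    ∃ Θ p q, p ≠ q ∧ f = faceVec₄ A Θ p q := by
  rcases Finset.mem_union.mp hf with hf | hf
  · obtain ⟨Θ, p, q, h, e⟩ := blockFaces_subset_redSet A ζ (Finset.mem_coe.mpr hf)
    exact ⟨Θ, p, q, h.1, e⟩
  · obtain ⟨k, -, rfl⟩ := Finset.mem_image.mp hf
    have hne : ((0 : Fin 4), u₁) ≠ ((0 : Fin 4), u₂) := fun e => h12 (Prod.mk.inj e).2
    have hne1 : ∀ u u' : A, ((0 : Fin 4), u) ≠ ((1 : Fin 4), u') := fun u u' e => absurd (Prod.mk.inj e).1 (by decide)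
    have hne2 : ∀ u u' : A, ((0 : Fin 4), u) ≠ ((2 : Fin 4), u') := fun u u' e => absurd (Prod.mk.inj e).1 (by decide)
    fin_cases k
    · exact ⟨_, _, _, hne, rfl⟩
    · exact ⟨_, _, _, hne, rfl⟩
    · exact ⟨_, _, _, hne, rfl⟩
    · exact ⟨_, _, _, hne, rfl⟩
    · exact ⟨_, _, _, hne, rfl⟩
    · exact ⟨_, _, _, hne1 _ _, rfl⟩
    · exact ⟨_, _, _, hne2 _ _, rfl⟩
    · exact ⟨_, _, _, hne1 _ _, rfl⟩
    · exact ⟨_, _, _, hne1 _ _, rfl⟩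
    · exact ⟨_, _, _, hne1 _ _, rfl⟩

end Gen

end

end Summit.HodgeConjecture.CorCM.Census.QuarticInversion
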